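import Literature.NumberTheory.EllipticCurves.PAdicOneVariableSocketCoatesWilesTwo
import Literature.NumberTheory.EllipticCurves.EisensteinNumbersPartialHeckeLTwist
import HarnessLib

/-!
# The SEAM ALGEBRA of de Shalit II.4.14 (38)→(40) at `j = 0`: from the per-unit moment values (MI) and their Frobenius images
# (fifth print) to the twisted class sum with the Euler factor `1 − ε(𝔭)⁻¹p⁻¹` — pure bookkeeping, proofs only

Topic `NumberTheory/EllipticCurves` (theorems only; no definition, no named fact, no instance beyond the lane's section-local
attributes).  Cell `bsd-print-cf2`, width seat `bsd-line-cf2-p1-w2` g24 (piece SEAM-ID, part 1); consumers: the seam identity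
«hsum» of `Theorems/PrintCf2RubinValueTwoKatzMeasureJZeroIntegrandOfClassSums.lean` (-w3 g31) assembled from
`…EllipticUnitsTwoVariableMomentsArtinSteps.integral_twoVariable_character_pow_succ_artin_steps` (H11, -w8 g11), the relative socket
`constantCoeff_mahlerD_iterate_subst_compSeriesC_relTildeSeries` (cf2c-w4 g11), the moment identification (MI, this seat:
`LubinTateColemanRelativeMomentLogCoordinateTwo`, `DeShalitThetaTExpansionMoments`) and the complex side
`DeShalit1987.sum_twist_eisensteinE_eq_removedEulerFactorsAtZero_mul_continuation` (-w7 g13).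

De Shalit II.4.14, proof of (36) at `j = 0` (p. 71–72): "(38) `≡ Ω_p^{−k} Σ_𝔠 χφ^k(𝔠⁻¹)·∫_{G_n} φ^k dμ_{σ_𝔠(β(𝔞))}` … If we write
`σ_𝔠(β(𝔞)) = β(𝔞𝔠)·β(𝔠)^{−N𝔞}`, we deduce at once from (26) and (17) … (39) … (40)": the sum over ray classes of the per-unit values
`δ_k − p^{k−1}φ(δ_k)` is the class sum of Eisenstein numbers times the Euler factor, because `φ` acts on the (algebraic) values as `σ_𝔭`
and multiplication by `𝔭` permutes the ray classes.  THIS FILE is that bookkeeping, abstractly (0 sorry):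

* §1 ★ `PowerSeries.constantCoeff_mahlerD_iterate_map_subst_compSeriesC_relTildeSeries` — the lane's per-unit term READ IN ANY RING `R` through
  `Θ : 𝐃 → R`: `[S⁰] D^k ((((δ_E g_β)~)^j ∘ ϑ)^Θ) = Θ(ε)^k · (Θ(j c_β) − Θ(j(w·π′^k)) · Θ(j(φ c_β)))`, `c_β = [X⁰] D_E^[k] (δ_E g_β)` (socket + `mahlerD`
  commutes with maps) — the shape of H11's summands;
* §2 (pure finite-sum algebra over a commutative ring `R` receiving `τ : ℂ →+* R`; ideals of a Dedekind domain `𝓞 K`):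
  `sub_mul_eq_of_perUnit` — if `X(𝔟) = A·τ(−12·(N𝔟·E₀ − E(𝔟)))` (MI's output: `E₀ = E_m(Ω, L_M)`, `E(𝔟) = E_m(Ω, L𝔟)`) then
  **`X(𝔞𝔡) − N𝔡·X(𝔞) = −12·A·τ(N𝔡·E(𝔞) − E(𝔞𝔡))`** (the `E₀`-terms cancel: II.4.10 Step 2 at the level of values);
  ★★ `sum_cells_perUnit_eq` — for labels `a, b` on a finite index set with `idl (b c′) = idl (a c′)·𝔡`, injective `idl ∘ a` with image `T`,
  weights `χg (a c′) = τ(𝒲(idl (a c′)))` and per-unit values `X`, `Φ` as above with `Φ`'s data the `𝔭`-TRANSLATED ones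
  (`Φ(𝔟) = A·τ(−12·ψ̂·(N𝔟·E(𝔭) − E(𝔭𝔟)))`, the Frobenius image per the fifth print + homogeneity) and `𝒲(𝔟) = 𝒲(𝔭𝔟)·w_𝔭` on `T`:
  **`Σ_{c′} χg(a c′)·((X(b c′) − N𝔡 X(a c′)) − W·(Φ(b c′) − N𝔡 Φ(a c′))) =
     −12·A·(τ(Σ_{𝔟∈T} 𝒲(𝔟)(N𝔡 E(𝔟) − E(𝔡𝔟))) − W·τ(ψ̂)·τ(w_𝔭)·τ(Σ_{𝔟′∈𝔭T} 𝒲(𝔟′)(N𝔡 E(𝔟′) − E(𝔡𝔟′))))`**;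
  `sum_cells_perUnit_eq_of_sum_image_eq` — if moreover the class sum is the same over `T` and over `𝔭T` (both are systems of representatives:
  `IsRayClassReps.image_mul`; the complex side evaluates either) and `W·τ(ψ̂)·τ(w_𝔭) = τ(e_v)`, the right side is
  **`−12·A·τ((1 − e_v)·Σ_{𝔟∈T} 𝒲(𝔟)(N𝔡 E(𝔟) − E(𝔡𝔟)))`** — the summand of -w7's complex side with the Euler factor `1 − e_v = 1 − ε(ϖ_v)⁻¹2⁻¹`.

No summit statement is proved; BSD is not proved by any of this.

## References
* [deShalit1987] E. de Shalit, *Iwasawa theory of elliptic curves with complex multiplication* (1987), II §4.7 (17) (p. 60), II §4.10 Step 2 (p. 64),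
  II §4.14 (38)–(40) (p. 71–72).
-/

noncomputable section

open PowerSeries

namespace Literature.NumberTheory.EllipticCurves

/-! ## §1 The lane's per-unit term read in any ring through `Θ : 𝐃 → R` -/

section SocketReading

open ValuativeRel IsLocalRing Field
open Literature.NumberTheory.GaloisRepresentations Literature.NumberTheory.GaloisRepresentations.IsNonarchimedeanLocalField
open Literature.NumberTheory.GaloisRepresentations.LubinTate
open Literature.NumberTheory.PAdicHodge

variable {F : Type} [Field F] [ValuativeRel F] [TopologicalSpace F] [IsNonarchimedeanLocalField F]

attribute [local instance] ltNormUniformSpace ltNormIsUniformAddGroup rk1 nF nE fintypeResidueField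

variable (hq : residueFieldCard F = 2) (h2 : (valuation F).IsUniformizer (((2 : ℕ) : 𝒪[F]) : F))
  {σ₀ : absoluteGaloisGroup F} (hσ₀ : IsAbsArithFrob σ₀) (u : 𝒪[F]ˣ)
  {ε : (maxUnramifiedCompletion F)ˣ}
  (hε : maxUnramifiedCompletion.galAut F σ₀ (ε : maxUnramifiedCompletion F) =
    algebraMap 𝒪[F] (maxUnramifiedCompletion F) (u : 𝒪[F]) * (ε : maxUnramifiedCompletion F))
  (E : IntermediateField F (AlgebraicClosure F)) [FiniteDimensional F E] [Normal F E] [IsGalois F E]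
  (hE : E ≤ maxUnramified F)
  (j : unitBall E →+* UnrCoeff F)
  (hj : j.comp (algebraMap (LTCoeff F) (unitBall E)) = (intToUnrCoeff F).comp (LTCoeff.of F).symm.toRingHom)

include hq hj in
/-- ★ **The lane's per-unit term read through `Θ`** (H11's summand): for `β ∈ 𝒰_E`, the tilde parameter `w`, and any ring map
`Θ : 𝐃 → R` (the lane: `Θ = θ ∘ (𝐃 ⊂ ℂ_F)` into `ℂ₂`),
`[S⁰] D^k (((((δ_E g_β)~)^j ∘ ϑ)^Θ) = Θ(ε)^k · (Θ(j c_β) − Θ(j w)·Θ(j π′)^k·Θ(j(φ c_β)))`, `c_β = [X⁰] D_E^[k] (δ_E g_β)`, `π′ = u·2`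
(socket `constantCoeff_mahlerD_iterate_subst_compSeriesC_relTildeSeries` + `constantCoeff_mahlerD_iterate_map`).
[cite: deShalit1987, Ch. I §3.5 (11) (p. 18), II §4.7 (17) (p. 60)] -/
theorem constantCoeff_mahlerD_iterate_map_subst_compSeriesC_relTildeSeries {R : Type*} [CommRing R]
    (Θ : UnrCoeff F →+* R) (w : LTCoeff F) (k : ℕ) (β : RelNormCoherentUnits (isUniformizer_unit_mul h2 u) E) :
    PowerSeries.constantCoeff (mahlerD^[k] (PowerSeries.map Θ
        (PowerSeries.subst (compSeriesC h2 hσ₀ u hε)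
          ((relTildeSeries (isUniformizer_unit_mul h2 u) E hq hE hσ₀ w β).map j)))) =
      Θ (PowerSeries.coeff 1 (compSeriesC h2 hσ₀ u hε)) ^ k *
        (Θ (j (PowerSeries.constantCoeff ((fun g : PowerSeries (unitBall E) =>
              (invDiff (isLTRing_LTCoeff (isUniformizer_unit_mul h2 u))
                  (isLTSeries_LTCoeff ((u : 𝒪[F]) * ((2 : ℕ) : 𝒪[F])))).map (algebraMap (LTCoeff F) (unitBall E)) *
                d⁄dX (unitBall E) g)^[k] (relLogDerivSeries (isUniformizer_unit_mul h2 u) E hq hE hσ₀ β)))) -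
          Θ (j (algebraMap (LTCoeff F) (unitBall E) w)) *
            Θ (j (algebraMap (LTCoeff F) (unitBall E) (LTCoeff.of F ((u : 𝒪[F]) * ((2 : ℕ) : 𝒪[F]))))) ^ k *
            Θ (j ((frobUnitBall E σ₀ : unitBall E →+* unitBall E)
              (PowerSeries.constantCoeff ((fun g : PowerSeries (unitBall E) =>
                (invDiff (isLTRing_LTCoeff (isUniformizer_unit_mul h2 u))
                    (isLTSeries_LTCoeff ((u : 𝒪[F]) * ((2 : ℕ) : 𝒪[F])))).map (algebraMap (LTCoeff F) (unitBall E)) *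
                  d⁄dX (unitBall E) g)^[k] (relLogDerivSeries (isUniformizer_unit_mul h2 u) E hq hE hσ₀ β)))))) := by
  rw [constantCoeff_mahlerD_iterate_map, constantCoeff_mahlerD_iterate_subst_compSeriesC_relTildeSeries hq h2 hσ₀ u hε E hE j hj w k β]
  simp only [map_mul Θ, map_pow Θ, map_sub Θ, map_mul j, map_pow j, map_sub j]

end SocketReading

/-! ## §2 The finite-sum algebra: per-unit values ↦ twisted class sum with the Euler factor -/

section CellSum

open IsDedekindDomain NumberField

variable {K : Type} [Field K] [NumberField K] {R : Type*} [CommRing R] (τ : ℂ →+* R)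

/-- **II.4.10 Step 2 at the level of values**: if `X(𝔟) = A·τ(−12·(N𝔟·E₀ − E(𝔟)))` for `𝔟 ∈ {𝔞, 𝔞𝔡}` then
`X(𝔞𝔡) − N𝔡·X(𝔞) = −12·A·τ(N𝔡·E(𝔞) − E(𝔞𝔡))` (the `E₀`-terms cancel since `N(𝔞𝔡) = N𝔞·N𝔡`).
[cite: deShalit1987, II §4.10 Step 2 (p. 64), II §4.14 (38)–(40) (p. 72)] -/
theorem sub_mul_eq_of_perUnit (A : R) (E₀ : ℂ) (Ev : Ideal (𝓞 K) → ℂ) {𝔞 𝔡 : Ideal (𝓞 K)} {Xa Xad : R}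
    (hXa : Xa = A * τ (-12 * ((Ideal.absNorm 𝔞 : ℂ) * E₀ - Ev 𝔞)))
    (hXad : Xad = A * τ (-12 * ((Ideal.absNorm (𝔞 * 𝔡) : ℂ) * E₀ - Ev (𝔞 * 𝔡)))) :
    Xad - (Ideal.absNorm 𝔡 : R) * Xa = -12 * A * τ ((Ideal.absNorm 𝔡 : ℂ) * Ev 𝔞 - Ev (𝔞 * 𝔡)) := by
  have hN : (Ideal.absNorm 𝔡 : R) = τ (Ideal.absNorm 𝔡 : ℂ) := by rw [map_natCast]
  rw [hXa, hXad, hN, map_mul Ideal.absNorm, Nat.cast_mul]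
  simp only [map_mul, map_sub, map_neg, map_natCast, map_ofNat]
  ring

/-- ★★ **The cell sum of the per-unit values** (II.4.14 (38)→(40) at `j = 0`, the `p`-adic side's bookkeeping): labels `a`, `b` on a finite
index set `C` with `idl (b c′) = idl (a c′)·𝔡`, `idl ∘ a` injective on `C` with image `T`, weights `χg (a c′) = τ(𝒲(idl (a c′)))` with
`𝒲(𝔟) = 𝒲(𝔭𝔟)·w_𝔭` on `T`, per-unit values `X` (data `E₀`, `E`) and Frobenius images `Φ` (data `ψ̂·E(𝔭)`, `ψ̂·E(𝔭·)`):
`Σ_{c′∈C} χg(a c′)·((X(b c′) − N𝔡·X(a c′)) − W·(Φ(b c′) − N𝔡·Φ(a c′)))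
 = −12·A·(τ(Σ_{𝔟∈T} 𝒲(𝔟)·(N𝔡·E(𝔟) − E(𝔡𝔟))) − W·τ(ψ̂)·τ(w_𝔭)·τ(Σ_{𝔟′∈𝔭T} 𝒲(𝔟′)·(N𝔡·E(𝔟′) − E(𝔡𝔟′))))`.
[cite: deShalit1987, II §4.14 (38)–(40) (p. 71–72), II §4.10 Step 2 (p. 64)] -/
theorem sum_cells_perUnit_eq {ι₀ I : Type*} [DecidableEq (Ideal (𝓞 K))] (C : Finset ι₀) (a b : ι₀ → I) (idl : I → Ideal (𝓞 K))
    {𝔡 𝔭 : Ideal (𝓞 K)} (h𝔭 : 𝔭 ≠ ⊥) (hb : ∀ c' ∈ C, idl (b c') = idl (a c') * 𝔡)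
    (hinj : Set.InjOn (fun c' ↦ idl (a c')) C) {T : Finset (Ideal (𝓞 K))} (hT : T = C.image fun c' ↦ idl (a c'))
    (χg X Φ : I → R) (𝒲 : Ideal (𝓞 K) → ℂ) (hχg : ∀ c' ∈ C, χg (a c') = τ (𝒲 (idl (a c'))))
    (w𝔭 : ℂ) (h𝒲 : ∀ 𝔟 ∈ T, 𝒲 𝔟 = 𝒲 (𝔭 * 𝔟) * w𝔭)
    (A W : R) (E₀ ψhat : ℂ) (Ev : Ideal (𝓞 K) → ℂ)
    (hX : ∀ c' ∈ C, X (a c') = A * τ (-12 * ((Ideal.absNorm (idl (a c')) : ℂ) * E₀ - Ev (idl (a c')))) ∧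
      X (b c') = A * τ (-12 * ((Ideal.absNorm (idl (b c')) : ℂ) * E₀ - Ev (idl (b c')))))
    (hΦ : ∀ c' ∈ C, Φ (a c') = A * τ (-12 * (ψhat * ((Ideal.absNorm (idl (a c')) : ℂ) * Ev 𝔭 - Ev (𝔭 * idl (a c'))))) ∧
      Φ (b c') = A * τ (-12 * (ψhat * ((Ideal.absNorm (idl (b c')) : ℂ) * Ev 𝔭 - Ev (𝔭 * idl (b c')))))) :
    ∑ c' ∈ C, χg (a c') * ((X (b c') - (Ideal.absNorm 𝔡 : R) * X (a c')) - W * (Φ (b c') - (Ideal.absNorm 𝔡 : R) * Φ (a c'))) =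
      -12 * A * (τ (∑ 𝔟 ∈ T, 𝒲 𝔟 * ((Ideal.absNorm 𝔡 : ℂ) * Ev 𝔟 - Ev (𝔡 * 𝔟))) -
        W * τ ψhat * τ w𝔭 * τ (∑ 𝔟' ∈ T.image (𝔭 * ·), 𝒲 𝔟' * ((Ideal.absNorm 𝔡 : ℂ) * Ev 𝔟' - Ev (𝔡 * 𝔟')))) := by
  -- per-cell simplification
  have hcell : ∀ c' ∈ C, χg (a c') * ((X (b c') - (Ideal.absNorm 𝔡 : R) * X (a c')) -
      W * (Φ (b c') - (Ideal.absNorm 𝔡 : R) * Φ (a c'))) =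
      -12 * A * (τ (𝒲 (idl (a c')) * ((Ideal.absNorm 𝔡 : ℂ) * Ev (idl (a c')) - Ev (𝔡 * idl (a c')))) -
        W * τ ψhat * τ w𝔭 * τ (𝒲 (𝔭 * idl (a c')) *
          ((Ideal.absNorm 𝔡 : ℂ) * Ev (𝔭 * idl (a c')) - Ev (𝔡 * (𝔭 * idl (a c')))))) := by
    intro c' hc'
    obtain ⟨hXa, hXb⟩ := hX c' hc'
    obtain ⟨hΦa, hΦb⟩ := hΦ c' hc'
    rw [hb c' hc'] at hXb hΦb
    -- the `X`-part
    have h1 : X (b c') - (Ideal.absNorm 𝔡 : R) * X (a c') =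
        -12 * A * τ ((Ideal.absNorm 𝔡 : ℂ) * Ev (idl (a c')) - Ev (idl (a c') * 𝔡)) :=
      sub_mul_eq_of_perUnit τ A E₀ Ev hXa hXb
    -- the `Φ`-part: the same computation for the data `ψ̂·E(𝔭)`, `ψ̂·E(𝔭·)` — write it through `sub_mul_eq_of_perUnit` with
    -- `E₀ := ψ̂·E(𝔭)`, `E := ψ̂·E(𝔭·)`
    have hΦa' : Φ (a c') = A * τ (-12 * ((Ideal.absNorm (idl (a c')) : ℂ) * (ψhat * Ev 𝔭) -
        (fun 𝔟 ↦ ψhat * Ev (𝔭 * 𝔟)) (idl (a c')))) := by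
      rw [hΦa]; congr 2; ring
    have hΦb' : Φ (b c') = A * τ (-12 * ((Ideal.absNorm (idl (a c') * 𝔡) : ℂ) * (ψhat * Ev 𝔭) -
        (fun 𝔟 ↦ ψhat * Ev (𝔭 * 𝔟)) (idl (a c') * 𝔡))) := by
      rw [hΦb]; congr 2; ring
    have h2 : Φ (b c') - (Ideal.absNorm 𝔡 : R) * Φ (a c') =
        -12 * A * τ ((Ideal.absNorm 𝔡 : ℂ) * (ψhat * Ev (𝔭 * idl (a c'))) - ψhat * Ev (𝔭 * (idl (a c') * 𝔡))) :=
      sub_mul_eq_of_perUnit τ A (ψhat * Ev 𝔭) (fun 𝔟 ↦ ψhat * Ev (𝔭 * 𝔟)) hΦa' hΦb'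
    rw [h1, h2, hχg c' hc', h𝒲 _ (by rw [hT]; exact Finset.mem_image_of_mem _ hc')]
    rw [show idl (a c') * 𝔡 = 𝔡 * idl (a c') from mul_comm _ _,
      show 𝔭 * (𝔡 * idl (a c')) = 𝔡 * (𝔭 * idl (a c')) from mul_left_comm _ _ _]
    simp only [map_mul, map_sub]
    ring
  rw [Finset.sum_congr rfl hcell, ← Finset.mul_sum, Finset.sum_sub_distrib, ← Finset.mul_sum, ← map_sum, ← map_sum]
  congr 2
  · rw [hT, Finset.sum_image hinj]
  · congr 1
    have hinj' : Set.InjOn (𝔭 * ·) (T : Set (Ideal (𝓞 K))) := fun x _ y _ h ↦ mul_left_cancel₀ h𝔭 h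
    rw [Finset.sum_image hinj', hT, Finset.sum_image hinj]

/-- ★★ **… with the two class sums identified and the Euler factor formed**: if the class sum `Σ 𝒲·(N𝔡·E − E(𝔡·))` takes the same value `S₀`
over `T` and over `𝔭T` (both are systems of representatives when `𝔭` is prime to the modulus — `IsRayClassReps.image_mul` — and the complex
side `sum_twist_eisensteinE_eq_removedEulerFactorsAtZero_mul_continuation` evaluates either) and `W·τ(ψ̂)·τ(w_𝔭) = τ(e_v)`, then the cell sum is
`−12·A·τ((1 − e_v)·S₀)` — de Shalit's (40): the Euler factor `1 − ε(𝔭)⁻¹p⁻¹` appears.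
[cite: deShalit1987, II §4.14 (38)–(40) (p. 71–72)] -/
theorem sum_cells_perUnit_eq_of_sum_image_eq {ι₀ I : Type*} [DecidableEq (Ideal (𝓞 K))] (C : Finset ι₀) (a b : ι₀ → I)
    (idl : I → Ideal (𝓞 K)) {𝔡 𝔭 : Ideal (𝓞 K)} (h𝔭 : 𝔭 ≠ ⊥) (hb : ∀ c' ∈ C, idl (b c') = idl (a c') * 𝔡)
    (hinj : Set.InjOn (fun c' ↦ idl (a c')) C) {T : Finset (Ideal (𝓞 K))} (hT : T = C.image fun c' ↦ idl (a c'))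
    (χg X Φ : I → R) (𝒲 : Ideal (𝓞 K) → ℂ) (hχg : ∀ c' ∈ C, χg (a c') = τ (𝒲 (idl (a c'))))
    (w𝔭 : ℂ) (h𝒲 : ∀ 𝔟 ∈ T, 𝒲 𝔟 = 𝒲 (𝔭 * 𝔟) * w𝔭)
    (A W : R) (E₀ ψhat : ℂ) (Ev : Ideal (𝓞 K) → ℂ)
    (hX : ∀ c' ∈ C, X (a c') = A * τ (-12 * ((Ideal.absNorm (idl (a c')) : ℂ) * E₀ - Ev (idl (a c')))) ∧
      X (b c') = A * τ (-12 * ((Ideal.absNorm (idl (b c')) : ℂ) * E₀ - Ev (idl (b c')))))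
    (hΦ : ∀ c' ∈ C, Φ (a c') = A * τ (-12 * (ψhat * ((Ideal.absNorm (idl (a c')) : ℂ) * Ev 𝔭 - Ev (𝔭 * idl (a c'))))) ∧
      Φ (b c') = A * τ (-12 * (ψhat * ((Ideal.absNorm (idl (b c')) : ℂ) * Ev 𝔭 - Ev (𝔭 * idl (b c'))))))
    {S₀ e_v : ℂ} (hST : ∑ 𝔟 ∈ T, 𝒲 𝔟 * ((Ideal.absNorm 𝔡 : ℂ) * Ev 𝔟 - Ev (𝔡 * 𝔟)) = S₀)
    (hST𝔭 : ∑ 𝔟' ∈ T.image (𝔭 * ·), 𝒲 𝔟' * ((Ideal.absNorm 𝔡 : ℂ) * Ev 𝔟' - Ev (𝔡 * 𝔟')) = S₀)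
    (hW : W * τ ψhat * τ w𝔭 = τ e_v) :
    ∑ c' ∈ C, χg (a c') * ((X (b c') - (Ideal.absNorm 𝔡 : R) * X (a c')) - W * (Φ (b c') - (Ideal.absNorm 𝔡 : R) * Φ (a c'))) =
      -12 * A * τ ((1 - e_v) * S₀) := by
  rw [sum_cells_perUnit_eq τ C a b idl h𝔭 hb hinj hT χg X Φ 𝒲 hχg w𝔭 h𝒲 A W E₀ ψhat Ev hX hΦ, hST, hST𝔭, hW, ← map_mul,
    ← map_sub]
  congr 1
  ring

end CellSum

end Literature.NumberTheory.EllipticCurves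

end
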